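import Summits.ABC.StewartYu.PadicG3TwoSizesN
import Summits.ABC.StewartYu.PadicG3TwoFirstExpSat
import Summits.ABC.StewartYu.PadicG3TwoScheduleArith
import Summits.ABC.StewartYu.PadicG3TwoSizesUnif
import HarnessLib

/-!
# Cell abc-stewartyu, WP-L.P(2) (crux r4 `PadicCoreTwoRat`, stmt-ABC-20504), record: SCHEDULE ARITHMETIC of the schedule of record
# `schedTwoN` (floored decrement, reserve, depth with `N`) in the letters of the parameter ledger `PadicG3Par`

`Summits/ABC/StewartYu/PadicG3TwoArithN.lean` — cell `abc-stewartyu` (HOME `run/shared/lean/pub/abc-stewartyu/`), route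
`YuMatveevShapeRat`, seat p3 (g10, WP-L.P(2) lead; memo-13 §1).  Theorems only (natural and real arithmetic); twin of p3-g6's
`PadicG3TwoScheduleArith` and p5's `PadicG3TwoSizesUnif` for the 𝔑-threaded schedule:
* decrement/ranges (`T3N_le : T3N I ≤ 4L` is lp-1's, `PadicG3TwoFirstExpSat`): `Xs3N_lt` (`Xs3N I < 3^I·X`), `Xs3N_zero_ge` (`(31/33)X ≤ Xs3N 0`), `Xs3N_mul_T3N_ge`
  (`(247/72)·X·L ≤ Xs3N I·T3N I` at EVERY level, floored or not, since `T3N ≥ 8`), `Nsub3N_real_le` (`≤ 3^{I+k+1}X`), `feld_arg_leN`;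
* depth: `three_pow_Istar3N_lt` (`3^{I*N} < 3·2^{n+24+m}·N`), `Istar3N_mul_log_three_lt`, and **`reserve_le_L`**: at `Nq = 2^{m+2}` and
  `N ≤ L`, `16(n+2)·(I*N+1) ≤ L` (so the order reserve is invisible in the budget and `T03N 0 − 1 ≤ Mord 0 0`);
* orders: `T03N_zero_le` (`T03N 0 ≤ (8n+20)·L`), `T03N_le_zero`, `T03N_zero_sub_one_le_Mord`.

WHAT THIS IS NOT: the size atoms (`N ≤ L`, boxes, `hboxvN`, `Xb3N`, `cardBN` in `P`-letters: sequel `PadicG3TwoArithBN`), the budget lines;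
no crux moves.

References: Yu. V. Nesterenko, LNM 1819 (2003), §4 (4.3)–(4.5), (3.24); K. Yu, Acta Math. 211 (2013), (5.23).
-/

noncomputable section

open Finset Real
open Literature.NumberTheory.Transcendental
open Literature.NumberTheory.Transcendental.CW77.Setup (Tau tauNorm)

namespace Summit.ABC.StewartYu

namespace TwoSetup

open Summit.ABC.StewartYu.G3Boxes PadicG3Par

variable (S : TwoSetup) (F : S.SatData) (P : PadicG3Par (S.d + 1))

/-! ### Decrement and ranges -/

/-- `T3N I ≤ 8L`. [folklore] -/
theorem T3N_le_eight_L (I : ℕ) : S.T3N P I ≤ 8 * P.L := (S.T3N_le P I).trans (by omega)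

/-- `T3N 0 = 4L`. [folklore] -/
theorem T3N_zero : S.T3N P 0 = 4 * P.L := by
  have hL : 2 ^ 25 ≤ P.L := by have h := P.two_pow_25_le_L; exact_mod_cast h
  unfold T3N; simp; omega

/-- **`Xs3N I < 3^I·X`** (real; `3^I·(T3N I + 1) > 4L` in both regimes). [folklore] -/
theorem Xs3N_lt (I : ℕ) : (S.Xs3N P I : ℝ) < (3 : ℝ) ^ I * P.X := by
  have hL : (0 : ℝ) < P.L := by linarith [P.one_le_L]
  have hX : (0 : ℝ) < P.X := by linarith [P.seventytwo_le_X]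
  have ht : (4 * P.L : ℝ) < 3 ^ I * ((S.T3N P I : ℝ) + 1) := by
    have h := Nat.lt_div_mul_add (a := 4 * P.L) (b := 3 ^ I) (by positivity)
    have hfl : 4 * P.L / 3 ^ I ≤ S.T3N P I := le_max_right _ _
    have : ((4 * P.L : ℕ) : ℝ) < ((4 * P.L / 3 ^ I * 3 ^ I + 3 ^ I : ℕ) : ℝ) := by exact_mod_cast h
    have hfl' : ((4 * P.L / 3 ^ I : ℕ) : ℝ) ≤ S.T3N P I := by exact_mod_cast hfl
    push_cast at this
    have h3 : (0 : ℝ) < (3 : ℝ) ^ I := by positivity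
    nlinarith
  have hXs : (S.Xs3N P I : ℝ) * ((S.T3N P I : ℝ) + 1) ≤ 4 * P.X * P.L := by
    have := (P.schedule_of_le (S.T3N_le_eight_L P I)).2.1
    unfold Xs3N; exact this
  have hpos : (0 : ℝ) < (S.T3N P I : ℝ) + 1 := by positivity
  by_contra hc
  push Not at hc
  have : (3 : ℝ) ^ I * P.X * ((S.T3N P I : ℝ) + 1) ≤ (S.Xs3N P I : ℝ) * ((S.T3N P I : ℝ) + 1) :=
    mul_le_mul_of_nonneg_right hc hpos.le
  nlinarith

/-- `Xs3N 0 ≤ X`. [folklore] -/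
theorem Xs3N_zero_le : (S.Xs3N P 0 : ℝ) ≤ P.X := by
  have := S.Xs3N_lt P 0; rw [pow_zero, one_mul] at this; exact this.le

/-- `(31/33)·X ≤ Xs3N 0`. [folklore] -/
theorem Xs3N_zero_ge : (31 / 33 : ℝ) * P.X ≤ S.Xs3N P 0 := by
  have hL : (2 : ℝ) ^ 25 ≤ P.L := P.two_pow_25_le_L
  have hX : (0 : ℝ) ≤ P.X := by positivity
  have hT := S.T3N_zero P
  have h := (P.schedule_of_le (S.T3N_le_eight_L P 0)).1
  have hXs : (31 / 8 : ℝ) * P.X * P.L ≤ (S.Xs3N P 0 : ℝ) * ((S.T3N P 0 : ℝ) + 1) := by unfold Xs3N; exact h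
  rw [hT] at hXs
  push_cast at hXs
  have hXs0 : (0 : ℝ) ≤ (S.Xs3N P 0 : ℝ) := by positivity
  have h1 : (S.Xs3N P 0 : ℝ) * (4 * (P.L : ℝ) + 1) ≤ (S.Xs3N P 0 : ℝ) * ((33 / 8) * P.L) :=
    mul_le_mul_of_nonneg_left (by linarith [show (8:ℝ) ≤ 2^25 by norm_num]) hXs0
  have hLpos : (0 : ℝ) < P.L := by linarith [show (0:ℝ) < 2^25 by norm_num]
  nlinarith

/-- **Zeros per sub-step at EVERY level**: `(247/72)·X·L ≤ Xs3N I · T3N I` (`T3N I ≥ 8` by the floor).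
[cite: Nesterenko2003, (4.3); shape only] -/
theorem Xs3N_mul_T3N_ge (I : ℕ) : (247 / 72 : ℝ) * P.X * P.L ≤ (S.Xs3N P I : ℝ) * (S.T3N P I : ℝ) := by
  have h := P.schedule_of_le (S.T3N_le_eight_L P I)
  have hlo : (31 / 8 : ℝ) * P.X * P.L ≤ (S.Xs3N P I : ℝ) * ((S.T3N P I : ℝ) + 1) := by unfold Xs3N; exact h.1
  have hhi : (S.Xs3N P I : ℝ) * ((S.T3N P I : ℝ) + 1) ≤ 4 * P.X * P.L := by unfold Xs3N; exact h.2.1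
  have hT' : (9 : ℝ) ≤ (S.T3N P I : ℝ) + 1 := by
    have : (8 : ℝ) ≤ (S.T3N P I : ℝ) := by exact_mod_cast S.T3N_ge P I
    linarith
  have hXs0 : (0 : ℝ) ≤ (S.Xs3N P I : ℝ) := by positivity
  have hXs : (S.Xs3N P I : ℝ) ≤ 4 * P.X * P.L / 9 := by
    rw [le_div_iff₀ (by norm_num)]
    nlinarith
  nlinarith

/-- **`Nsub3N I k ≤ 3^{I+k+1}·X`.** [cite: Yu2013, (5.23); shape only] -/
theorem Nsub3N_real_le (I k : ℕ) : (S.Nsub3N P I k : ℝ) ≤ (3 : ℝ) ^ (I + k + 1) * P.X := by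
  have hXs := (S.Xs3N_lt P I).le
  have hX : (0 : ℝ) ≤ P.X := by positivity
  have hXs0 : (0 : ℝ) ≤ (S.Xs3N P I : ℝ) := by positivity
  have h3I : (1 : ℝ) ≤ (3 : ℝ) ^ I := one_le_pow₀ (by norm_num)
  have h3k : (1 : ℝ) ≤ (3 : ℝ) ^ k := one_le_pow₀ (by norm_num)
  have epow : (3 : ℝ) ^ (I + k + 1) = (3 : ℝ) ^ I * (3 : ℝ) ^ k * 3 := by rw [pow_succ, pow_add]
  rw [epow]
  unfold Nsub3N
  split_ifs with hk hI
  · nlinarith [mul_le_mul h3I h3k zero_le_one (le_trans zero_le_one h3I)]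
  · push_cast
    nlinarith [mul_le_mul_of_nonneg_left h3k (le_trans zero_le_one h3I), hXs]
  · push_cast
    have h1 : (3 : ℝ) ^ k * (S.Xs3N P I : ℝ) ≤ (3 : ℝ) ^ k * ((3 : ℝ) ^ I * P.X) :=
      mul_le_mul_of_nonneg_left hXs (by positivity)
    nlinarith [h1]

/-- **The Fel'dman argument is level-independent**: `3^{I*N−I}·|x₁| ≤ 3^{I*N+k+1}·X` for `I ≤ I*N`, `|x₁| ≤ Nsub3N I k`.
[cite: Nesterenko2003, (4.45); shape only] -/
theorem feld_arg_leN {I k : ℕ} (hI : I ≤ S.Istar3N F P) {x₁ : ℤ} (hx : |x₁| ≤ (S.Nsub3N P I k : ℤ)) :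
    (3 : ℝ) ^ (S.Istar3N F P - I) * |(x₁ : ℝ)| ≤ (3 : ℝ) ^ (S.Istar3N F P + k + 1) * P.X := by
  have hx' : |(x₁ : ℝ)| ≤ (S.Nsub3N P I k : ℝ) := by exact_mod_cast hx
  have hN := S.Nsub3N_real_le P I k
  have e : (3 : ℝ) ^ (S.Istar3N F P + k + 1) = (3 : ℝ) ^ (S.Istar3N F P - I) * (3 : ℝ) ^ (I + k + 1) := by
    rw [← pow_add]; congr 1; omega
  rw [e, mul_assoc]
  exact mul_le_mul_of_nonneg_left (hx'.trans hN) (by positivity)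

/-! ### The depth -/

/-- `3^{I*N} < 3·2^{n+24+m}·N`. [folklore] -/
theorem three_pow_Istar3N_lt : 3 ^ S.Istar3N F P < 3 * (2 ^ (S.d + 1 + 24 + P.m) * F.N) := by
  have hx : 1 < 2 ^ (S.d + 1 + 24 + P.m) * F.N :=
    lt_of_lt_of_le (Nat.one_lt_two_pow (by omega)) (Nat.le_mul_of_pos_right _ F.hN)
  have h := Nat.pow_pred_clog_lt_self (by norm_num : 1 < 3) hx
  have hpos : 0 < S.Istar3N F P := Nat.clog_pos (by norm_num) hx
  unfold Istar3N at hpos ⊢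
  have e : 3 ^ Nat.clog 3 (2 ^ (S.d + 1 + 24 + P.m) * F.N) = 3 * 3 ^ (Nat.clog 3 (2 ^ (S.d + 1 + 24 + P.m) * F.N) - 1) := by
    rw [← pow_succ']; congr 1; omega
  rw [e]
  exact Nat.mul_lt_mul_of_pos_left h (by norm_num)

/-- **Depth in logs**: `I*N·log 3 < log 3 + (n+24+m)·log 2 + log N`. [folklore] -/
theorem Istar3N_mul_log_three_lt :
    (S.Istar3N F P : ℝ) * Real.log 3 < Real.log 3 + ((S.d : ℝ) + 1 + 24 + P.m) * Real.log 2 + Real.log F.N := by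
  have h := S.three_pow_Istar3N_lt F P
  have hN : (0 : ℝ) < F.N := by exact_mod_cast F.hN
  have h' : ((3 : ℕ) : ℝ) ^ S.Istar3N F P < 3 * (((2 : ℕ) : ℝ) ^ (S.d + 1 + 24 + P.m) * F.N) := by exact_mod_cast h
  have hlog := Real.log_lt_log (by positivity) h'
  rw [Real.log_pow, Real.log_mul (by norm_num) (by positivity), Real.log_mul (by positivity) hN.ne', Real.log_pow] at hlog
  push_cast at hlog
  linarith

/-- `I*N ≤ n + 26 + m + log₂ N` (from `2^{I*N} ≤ 3^{I*N} < 3·2^{n+24+m}·N ≤ 2^{n+26+m}·N`). [folklore] -/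
theorem Istar3N_le_log : S.Istar3N F P ≤ S.d + 1 + 26 + P.m + Nat.log 2 F.N := by
  have h := S.three_pow_Istar3N_lt F P
  have h2 : 2 ^ S.Istar3N F P < 2 ^ (S.d + 1 + 26 + P.m) * F.N := by
    calc 2 ^ S.Istar3N F P ≤ 3 ^ S.Istar3N F P := Nat.pow_le_pow_left (by norm_num) _
      _ < 3 * (2 ^ (S.d + 1 + 24 + P.m) * F.N) := h
      _ ≤ 4 * (2 ^ (S.d + 1 + 24 + P.m) * F.N) := Nat.mul_le_mul_right _ (by norm_num)
      _ = 2 ^ (S.d + 1 + 26 + P.m) * F.N := by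
          rw [show S.d + 1 + 26 + P.m = (S.d + 1 + 24 + P.m) + 2 by ring, pow_add]; ring
  have hN : F.N < 2 ^ (Nat.log 2 F.N + 1) := Nat.lt_pow_succ_log_self (by norm_num) _
  have h3 : 2 ^ S.Istar3N F P < 2 ^ (S.d + 1 + 26 + P.m + (Nat.log 2 F.N + 1)) := by
    rw [pow_add]
    exact lt_of_lt_of_le h2 (Nat.mul_le_mul_left _ hN.le)
  have := (Nat.pow_lt_pow_iff_right (by norm_num : 1 < 2)).mp h3
  omega

/-- `32·k² ≤ 2^k` for `k ≥ 15`. [folklore] -/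
theorem thirtytwo_mul_sq_le_two_pow {k : ℕ} (hk : 15 ≤ k) : 32 * k ^ 2 ≤ 2 ^ k := by
  induction k, hk using Nat.le_induction with
  | base => norm_num
  | succ k hk ih =>
    have h1 : 32 * (k + 1) ^ 2 ≤ 2 * (32 * k ^ 2) := by nlinarith
    calc 32 * (k + 1) ^ 2 ≤ 2 * (32 * k ^ 2) := h1
      _ ≤ 2 * 2 ^ k := Nat.mul_le_mul_left _ ih
      _ = 2 ^ (k + 1) := by rw [pow_succ]; ring

/-- **The order reserve is below `L`**: at `Nq = 2^{m+2}` and `N ≤ L`, `16(n+2)·(I*N + 1) ≤ L`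
(`I*N + 1 ≤ 2·log₂ L`, `n + 2 ≤ log₂ L`, `32·(log₂ L)² ≤ L`). [folklore] -/
theorem reserve_le_L (hNq : P.Nq = 2 ^ (P.m + 2)) (hNL : F.N ≤ P.L) :
    16 * (S.d + 1 + 2) * (S.Istar3N F P + 1) ≤ P.L := by
  have hL := P.two_pow_mul_Nq_le_L
  rw [hNq, ← pow_add] at hL
  -- `k := log₂ L ≥ n + 27 + m`
  set k := Nat.log 2 P.L with hk
  have hLpos : 0 < P.L := lt_of_lt_of_le (by positivity) hL
  have hk1 : S.d + 1 + 25 + (P.m + 2) ≤ k := by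
    rw [hk]; exact Nat.le_log_of_pow_le (by norm_num) hL
  have hk2 : P.L < 2 ^ (k + 1) := Nat.lt_pow_succ_log_self (by norm_num) _
  have hlogN : Nat.log 2 F.N ≤ k := by rw [hk]; exact Nat.log_mono_right hNL
  have hI := S.Istar3N_le_log F P
  have hI2 : S.Istar3N F P + 1 ≤ 2 * k := by omega
  have hn2 : S.d + 1 + 2 ≤ k := by omega
  have hsq := thirtytwo_mul_sq_le_two_pow (show 15 ≤ k by omega)
  have hpow : 2 ^ k ≤ P.L := by rw [hk]; exact Nat.pow_log_le_self 2 hLpos.ne'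
  calc 16 * (S.d + 1 + 2) * (S.Istar3N F P + 1) ≤ 16 * k * (2 * k) :=
        Nat.mul_le_mul (Nat.mul_le_mul_left _ hn2) hI2
    _ = 32 * k ^ 2 := by ring
    _ ≤ 2 ^ k := hsq
    _ ≤ P.L := hpow

/-! ### The orders -/

/-- **Start order**: `T03N 0 ≤ (8n+20)·L` given the reserve bound (`M/(n+2)³ ≤ 2L`, `T3N 0 = 4L`). [folklore] -/
theorem T03N_zero_le (hres : 16 * (S.d + 1 + 2) * (S.Istar3N F P + 1) ≤ P.L) :
    (S.T03N F P 0 : ℝ) ≤ (8 * ((S.d : ℝ) + 1) + 20) * P.L := by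
  have hL : 1 ≤ P.L := by have := P.two_pow_le_L; have : 1 ≤ 2 ^ (S.d + 1 + 24) := Nat.one_le_two_pow; omega
  have hM : P.M / (S.d + 1 + 2) ^ 3 ≤ 2 * P.L := by
    rw [P.M_eq]
    calc 16 * (S.d + 1 + 1) * P.L / (S.d + 1 + 2) ^ 3 ≤ 2 * (S.d + 1 + 2) ^ 3 * P.L / (S.d + 1 + 2) ^ 3 := by
          apply Nat.div_le_div_right
          have h9 : 9 ≤ (S.d + 1 + 2) ^ 2 := by
            have := Nat.pow_le_pow_left (show 3 ≤ S.d + 1 + 2 by omega) 2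
            simpa using this
          have : 16 * (S.d + 1 + 1) ≤ 2 * (S.d + 1 + 2) ^ 3 := by
            calc 16 * (S.d + 1 + 1) ≤ 2 * (9 * (S.d + 1 + 2)) := by omega
              _ ≤ 2 * ((S.d + 1 + 2) ^ 2 * (S.d + 1 + 2)) := by
                  exact Nat.mul_le_mul_left _ (Nat.mul_le_mul_right _ h9)
              _ = 2 * (S.d + 1 + 2) ^ 3 := by ring
          exact Nat.mul_le_mul_right _ this
      _ = 2 * P.L := by
          rw [mul_assoc, mul_comm ((S.d+1+2)^3) P.L, ← mul_assoc, Nat.mul_div_cancel _ (by positivity)]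
  have hT := S.T3N_zero P
  have h : S.T03N F P 0 ≤ (8 * (S.d + 1) + 20) * P.L := by
    unfold T03N; rw [hT]
    have : 16 * (S.d + 1 + 2) * (S.Istar3N F P + 1 - 0) ≤ P.L := by simpa using hres
    nlinarith
  have h' : ((S.T03N F P 0 : ℕ) : ℝ) ≤ (((8 * (S.d + 1) + 20) * P.L : ℕ) : ℝ) := by exact_mod_cast h
  push_cast at h'
  linarith

/-- `T03N` is antitone in the level. [folklore] -/
theorem T03N_le_zero (I : ℕ) : S.T03N F P I ≤ S.T03N F P 0 := by
  unfold T03N T3N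
  have h1 : 4 * P.L / 3 ^ I ≤ 4 * P.L / 3 ^ 0 := Nat.div_le_div_left (Nat.one_le_pow _ _ (by norm_num)) (by norm_num)
  have h2 : max 8 (4 * P.L / 3 ^ I) ≤ max 8 (4 * P.L / 3 ^ 0) := max_le_max le_rfl h1
  have h3 : S.Istar3N F P + 1 - I ≤ S.Istar3N F P + 1 - 0 := by omega
  nlinarith [Nat.mul_le_mul_left (16 * (S.d + 1 + 2)) h3, Nat.mul_le_mul_left (2 * (S.d + 1 + 2)) h2]

/-- **`T03N 0 − 1 ≤ Mord 0 0`** given the reserve bound (so (L1N) may use p1's `choose_Mord_le`).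
[cite: Nesterenko2003, (4.5); shape only] -/
theorem T03N_zero_sub_one_le_Mord (hres : 16 * (S.d + 1 + 2) * (S.Istar3N F P + 1) ≤ P.L) :
    S.T03N F P 0 - 1 ≤ P.Mord 0 0 := by
  have hL1 : 1 ≤ P.L := by have := P.two_pow_le_L; have : 1 ≤ 2 ^ (S.d + 1 + 24) := Nat.one_le_two_pow; omega
  have hT := S.T3N_zero P
  have key : 2 * (S.d + 1 + 2) * S.T3N P 0 + 1 + 16 * (S.d + 1 + 2) * (S.Istar3N F P + 1 - 0) ≤
      P.T 0 * (2 * (S.d + 1 + 1) - 0) + 1 := by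
    rw [hT]
    unfold PadicG3Par.T
    simp only [pow_zero, Nat.div_one, Nat.sub_zero]
    nlinarith [hres, hL1]
  unfold T03N PadicG3Par.Mord
  generalize P.M / (S.d + 1 + 2) ^ 3 = M₃ at key ⊢
  omega

end TwoSetup

end Summit.ABC.StewartYu

end
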